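import Literature.Analysis.Complex.DbarPoincarePolydisc
import Mathlib.Analysis.SpecialFunctions.Complex.Arg
import Mathlib.Analysis.SpecialFunctions.Trigonometric.Arctan
import HarnessLib

/-!
# Real-centred discs in sectors, and polydisc charts of argument-solid domains

Analysis/Complex support file (everything proved; no definitions, no named facts). Two pieces of
plane geometry used to feed the Osterwalder–Schrader regions into the polydisc theorems of
`PositiveKernelPolydisc` / `OSHolomorphicVectors`:

* `re_pos_and_abs_arg_lt_of_norm_sub_lt` — the open disc of radius `ξ sin α` about a point
  `ξ > 0` of the positive real axis lies in the sector `{Re z > 0, |arg z| < α}` (`0 < α < π/2`):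
  its boundary circle is tangent to the rays `arg z = ±α`.
* `exists_polydisc_chart_of_argSolid` — let `d ⊆ (-π/2, π/2)ᵐ` be open and **solid**
  (`v ∈ d`, `|wᵢ| ≤ |vᵢ|` for all `i` implies `w ∈ d`; Osterwalder–Schrader II, p. 296: "the whole
  hyperrectangle with corners `(±v₁, …, ±v_k)` is also contained", `OSEnvelopeBases.osBaseD_solid`),
  and let `ζ ∈ ℂᵐ` have `Re ζᵢ > 0` and `(arg ζᵢ)ᵢ ∈ d`. Then there are a polydisc
  `P = ∏ D(ξᵢ, rᵢ)` with real centre `ξᵢ > 0` containing `ζ`, and angles `φ ∈ d`, `φᵢ > 0`, such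
  that every `z ∈ P` has `Re zᵢ > 0` and `|arg zᵢ| < φᵢ` — so that `P`, and (by solidity of the
  relevant bases) the pairs `P̄ × P`, stay inside the OS regions. This is OS II, Ch. V.2, p. 294:
  "observe that with `(x, ζ)` the whole cone of points of the form `(x, ζ')` with `x > 0`,
  `|arg ζ'ᵢ| ≤ |arg ζᵢ|` … is contained in `D_n^{(N)}`. We therefore can find points
  `ξᵢ ∈ (0, ∞)` and numbers `rᵢ > 0`, such that the whole polydisc
  `P = {(x, ζ') | |ζ'ᵢ - ξᵢ| < rᵢ}` is contained in `D_n^{(N)}` and `(x, ζ) ∈ P`" (with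
  `ξᵢ = |ζᵢ|²/Re ζᵢ`, `rᵢ = ξᵢ sin φᵢ`, `φᵢ = |arg ζᵢ| + δ`).

## References

* K. Osterwalder, R. Schrader, *Axioms for Euclidean Green's functions II*, Comm. Math. Phys. 42
  (1975) 281–305, Ch. V.2 p. 294 (before (5.20)) and p. 296. [OsterwalderSchraderCMP1975]
-/

noncomputable section

open Metric Set Complex Real

namespace Literature.Analysis.Complex

/-! ### A real-centred disc tangent to the rays `arg = ±α` -/

/-- Cauchy–Schwarz in the plane for a unit vector `(a, b)`: `|a x + b y| ≤ ‖x + iy‖`. [folklore] -/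
theorem abs_mul_re_add_mul_im_le {a b : ℝ} (hab : a ^ 2 + b ^ 2 = 1) (w : ℂ) :
    |a * w.re + b * w.im| ≤ ‖w‖ := by
  have hsq : (a * w.re + b * w.im) ^ 2 ≤ ‖w‖ ^ 2 := by
    rw [Complex.sq_norm, Complex.normSq_apply]
    nlinarith [sq_nonneg (a * w.im - b * w.re), hab]
  exact abs_le_of_sq_le_sq' hsq (norm_nonneg _) |> fun h => abs_le.2 h

/-- **A disc about a real point `ξ` of radius `ξ sin α` lies in the sector `|arg z| < α`**
(`0 < α < π/2`), and in the right half-plane (vacuous unless `ξ > 0`). [folklore] -/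
theorem re_pos_and_abs_arg_lt_of_norm_sub_lt {ξ α : ℝ} (hα0 : 0 < α)
    (hα : α < π / 2) {z : ℂ} (hz : ‖z - ξ‖ < ξ * Real.sin α) :
    0 < z.re ∧ |Complex.arg z| < α := by
  have hsin : 0 < Real.sin α := Real.sin_pos_of_pos_of_lt_pi hα0 (by linarith [Real.pi_pos])
  have hcos : 0 < Real.cos α := Real.cos_pos_of_mem_Ioo ⟨by linarith, hα⟩
  have hunit : (-Real.sin α) ^ 2 + Real.cos α ^ 2 = 1 := by
    rw [neg_sq]; exact Real.sin_sq_add_cos_sq α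
  have hunit' : (-Real.sin α) ^ 2 + (-Real.cos α) ^ 2 = 1 := by
    rw [neg_sq, neg_sq]; exact Real.sin_sq_add_cos_sq α
  -- the two tangent functionals applied to `w = z - ξ`
  have h1 := (abs_le.1 (abs_mul_re_add_mul_im_le hunit (z - ξ))).2
  have h2 := (abs_le.1 (abs_mul_re_add_mul_im_le hunit' (z - ξ))).2
  simp only [Complex.sub_re, Complex.ofReal_re, Complex.sub_im, Complex.ofReal_im, sub_zero] at h1 h2
  -- `cos α · Im z < sin α · Re z` and `-cos α · Im z < sin α · Re z`
  have hA : Real.cos α * z.im < Real.sin α * z.re := by nlinarith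
  have hB : -(Real.cos α * z.im) < Real.sin α * z.re := by nlinarith
  have habs : Real.cos α * |z.im| < Real.sin α * z.re := by
    rcases le_or_gt 0 z.im with h | h
    · rwa [abs_of_nonneg h]
    · rw [abs_of_neg h, mul_neg]; exact hB
  have hre : 0 < z.re := by
    have : 0 ≤ Real.cos α * |z.im| := mul_nonneg hcos.le (abs_nonneg _)
    nlinarith
  refine ⟨hre, ?_⟩
  -- compare tangents on `(-π/2, π/2)`
  have harg : |Complex.arg z| < π / 2 := Complex.abs_arg_lt_pi_div_two_iff.2 (Or.inl hre)
  have htan : |Real.tan (Complex.arg z)| < Real.tan α := by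
    rw [Complex.tan_arg, abs_div, abs_of_pos hre, div_lt_iff₀ hre, Real.tan_eq_sin_div_cos,
      div_mul_eq_mul_div, lt_div_iff₀ hcos]
    linarith
  have hmono := Real.strictMonoOn_tan
  have hαI : α ∈ Ioo (-(π / 2)) (π / 2) := ⟨by linarith, hα⟩
  have hnαI : -α ∈ Ioo (-(π / 2)) (π / 2) := ⟨by linarith, by linarith⟩
  have hzI : Complex.arg z ∈ Ioo (-(π / 2)) (π / 2) := ⟨by linarith [(abs_lt.1 harg).1], (abs_lt.1 harg).2⟩
  rw [abs_lt]
  constructor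
  · by_contra hle
    push Not at hle
    have := hmono.monotoneOn hzI hnαI hle
    rw [Real.tan_neg] at this
    linarith [(abs_lt.1 htan).1]
  · by_contra hle
    push Not at hle
    have := hmono.monotoneOn hαI hzI hle
    linarith [(abs_lt.1 htan).2]

/-- The distance from `ζ` (`Re ζ > 0`) to the real point `ξ = |ζ|²/Re ζ`:
`‖ζ - ξ‖² = ξ² - |ζ|²`. [folklore] -/
theorem norm_sub_normSq_div_re_sq {ζ : ℂ} (hζ : 0 < ζ.re) :
    ‖ζ - ((‖ζ‖ ^ 2 / ζ.re : ℝ) : ℂ)‖ ^ 2 = (‖ζ‖ ^ 2 / ζ.re) ^ 2 - ‖ζ‖ ^ 2 := by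
  rw [Complex.sq_norm, Complex.sq_norm, Complex.normSq_apply, Complex.normSq_apply]
  simp only [Complex.sub_re, Complex.ofReal_re, Complex.sub_im, Complex.ofReal_im, sub_zero]
  field_simp
  ring

/-! ### Polydisc charts of argument-solid domains -/

/-- **Polydisc charts** (OS II, Ch. V.2, p. 294, the polydisc `P` before (5.20)). Let
`d ⊆ (-π/2, π/2)ᵐ` be open and solid and let `ζ ∈ ℂᵐ` have `Re ζᵢ > 0`, `(arg ζᵢ)ᵢ ∈ d`. Then
there are `ξᵢ > 0`, `rᵢ > 0` and `φ ∈ d` with `φᵢ > 0` such that `ζ` lies in the polydisc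
`∏ D(ξᵢ, rᵢ)` and every point `z` of it has `Re zᵢ > 0` and `|arg zᵢ| < φᵢ`. [cite: OsterwalderSchraderCMP1975, Ch. V.2 p. 294] -/
theorem exists_polydisc_chart_of_argSolid {m : ℕ} {d : Set (Fin m → ℝ)} (hd : IsOpen d)
    (hsolid : ∀ v ∈ d, ∀ w : Fin m → ℝ, (∀ i, |w i| ≤ |v i|) → w ∈ d)
    (hcube : d ⊆ {v | ∀ i, |v i| < π / 2})
    {ζ : Fin m → ℂ} (hζre : ∀ i, 0 < (ζ i).re) (hζ : (fun i => Complex.arg (ζ i)) ∈ d) :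
    ∃ ξ r φ : Fin m → ℝ, (∀ i, 0 < ξ i) ∧ (∀ i, 0 < r i) ∧ φ ∈ d ∧ (∀ i, 0 < φ i) ∧
      ζ ∈ polydisc (fun i => (ξ i : ℂ)) r ∧
      ∀ z ∈ polydisc (fun i => (ξ i : ℂ)) r, ∀ i, 0 < (z i).re ∧ |Complex.arg (z i)| < φ i := by
  -- the absolute arguments are in `d`, with a margin `δ`
  have habs : (fun i => |Complex.arg (ζ i)|) ∈ d := hsolid _ hζ _ fun i => by rw [abs_abs]
  obtain ⟨ε, hε, hball⟩ := Metric.isOpen_iff.1 hd _ habs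
  set δ : ℝ := ε / 2 with hδ
  have hδ0 : 0 < δ := by positivity
  set φ : Fin m → ℝ := fun i => |Complex.arg (ζ i)| + δ with hφ
  have hφd : φ ∈ d := hball (by
    rw [mem_ball, dist_pi_lt_iff hε]
    intro i
    simp only [hφ, Real.dist_eq, add_sub_cancel_left]
    rw [abs_of_pos hδ0, hδ]
    linarith)
  have hφ0 : ∀ i, 0 < φ i := fun i => by simp only [hφ]; positivity
  have hφlt : ∀ i, φ i < π / 2 := fun i => by
    have := hcube hφd i
    exact lt_of_abs_lt this
  have hargφ : ∀ i, |Complex.arg (ζ i)| < φ i := fun i => by simp only [hφ]; linarith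
  -- centres and radii
  set ξ : Fin m → ℝ := fun i => ‖ζ i‖ ^ 2 / (ζ i).re with hξ
  have hζ0 : ∀ i, ζ i ≠ 0 := fun i h => by have := hζre i; rw [h] at this; simp at this
  have hξ0 : ∀ i, 0 < ξ i := fun i => div_pos (pow_pos (norm_pos_iff.2 (hζ0 i)) 2) (hζre i)
  set r : Fin m → ℝ := fun i => ξ i * Real.sin (φ i) with hr
  have hsinφ : ∀ i, 0 < Real.sin (φ i) := fun i =>
    Real.sin_pos_of_pos_of_lt_pi (hφ0 i) (by linarith [hφlt i, Real.pi_pos])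
  have hcosφ : ∀ i, 0 < Real.cos (φ i) := fun i =>
    Real.cos_pos_of_mem_Ioo ⟨by linarith [hφ0 i, Real.pi_pos], hφlt i⟩
  have hr0 : ∀ i, 0 < r i := fun i => mul_pos (hξ0 i) (hsinφ i)
  refine ⟨ξ, r, φ, hξ0, hr0, hφd, hφ0, ?_, ?_⟩
  · -- `ζ ∈ P`: `‖ζᵢ - ξᵢ‖² = ξᵢ² - |ζᵢ|² < ξᵢ² sin² φᵢ`
    rw [mem_polydisc]
    intro i
    rw [mem_ball, dist_eq_norm]
    have hsq : ‖ζ i - (ξ i : ℂ)‖ ^ 2 < (r i) ^ 2 := by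
      have e1 : ‖ζ i - (ξ i : ℂ)‖ ^ 2 = (ξ i) ^ 2 - ‖ζ i‖ ^ 2 := by
        simp only [hξ]; exact norm_sub_normSq_div_re_sq (hζre i)
      rw [e1, hr]
      simp only
      rw [mul_pow, Real.sin_sq]
      -- `ξ² - |ζ|² < ξ² (1 - cos² φ)` iff `ξ cos φ < |ζ|` iff `cos φ < cos (arg ζ)`
      have hcosarg : Real.cos (Complex.arg (ζ i)) = (ζ i).re / ‖ζ i‖ := Complex.cos_arg (hζ0 i)
      have hlt : Real.cos (φ i) < Real.cos (Complex.arg (ζ i)) := by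
        rw [← Real.cos_abs (Complex.arg (ζ i))]
        exact Real.cos_lt_cos_of_nonneg_of_le_pi (abs_nonneg _) (by linarith [hφlt i, Real.pi_pos])
          (hargφ i)
      have hn : 0 < ‖ζ i‖ := norm_pos_iff.2 (hζ0 i)
      have hξcos : ξ i * Real.cos (φ i) < ‖ζ i‖ := by
        rw [hcosarg, lt_div_iff₀ hn] at hlt
        have : ξ i * Real.cos (φ i) * (ζ i).re < ‖ζ i‖ * (ζ i).re := by
          have hre0 : (ζ i).re ≠ 0 := (hζre i).ne'
          calc ξ i * Real.cos (φ i) * (ζ i).re = ‖ζ i‖ ^ 2 * Real.cos (φ i) := by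
                simp only [hξ]; field_simp
            _ = ‖ζ i‖ * (Real.cos (φ i) * ‖ζ i‖) := by ring
            _ < ‖ζ i‖ * (ζ i).re := mul_lt_mul_of_pos_left hlt hn
        exact lt_of_mul_lt_mul_right this (hζre i).le
      have h0 : 0 ≤ ξ i * Real.cos (φ i) := mul_nonneg (hξ0 i).le (hcosφ i).le
      nlinarith [mul_self_lt_mul_self h0 hξcos]
    exact lt_of_pow_lt_pow_left₀ 2 (hr0 i).le hsq
  · intro z hz i
    have h := mem_polydisc.1 hz i
    rw [mem_ball, dist_eq_norm] at h
    exact re_pos_and_abs_arg_lt_of_norm_sub_lt (hφ0 i) (hφlt i) h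

end Literature.Analysis.Complex
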